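import Summits.HodgeConjecture.HodgeConjecture.Theorems.F0P3LettersRouting          -- ★ p823358: the LETTER #82 `CohClassRouting` (+ ★ `clFinChoice`, `admUnitConstituents`, D6, the ξ-side of record)
import Literature.NumberTheory.Rogawski1990.SquareIntegrableNotSphericalCofinite         -- ★ p825942 typed LETTER (SqNS) `SquareIntegrableNotSphericalCofinite` (shared with #79)
import Literature.NumberTheory.Automorphic.IrreducibleClassesComapInner                  -- ★ p825897 (this seat, K5a): `IrrClass.comap_symm_eq_comap_symm_of_forall_eq_conj`
import Literature.NumberTheory.Automorphic.LocalUnitaryGroupCongrInner                   -- ★ p826024 (this seat, K5b): `UnitaryGroup.exists_cmDatumLocalCongr_eq_apply_conj`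
import Literature.NumberTheory.Rogawski1990.SupercuspidalNotSphericalCofinite             -- ★ p826064∕p826158 (typ-T2a (g0), K3): `…eventually_not_isSupercuspidal_of_isSpherical_congr`
import Literature.NumberTheory.Automorphic.LocalUnitaryGroupCenter                         -- ★ p825780 (A-p19 (g17)): `forall_mem_center_cmLocal_eq_scalar` (central ⇒ scalar)
import Summits.HodgeConjecture.HodgeConjecture.Theorems.F0P3bLocalNonsplitCompactCenter    -- ★ p825600 (A-p19 (g17)): `local_nonsplit_compactOpen_center_of_center_le` (compact centre at non-split `v`)
import HarnessLib

/-!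
# Crux `H413` — #82 (L3′) pay-down, THE LOCAL GLUE AS A THEOREM: «local class routing from ξ-envelope membership» (`localRouting_of_memXiFamily`)

F0∕P3 «U3-mult», cell `hodgecm-mathlib`, crux item `stmt-HodgeConjecture-24833`.  LIFTED VERBATIM (statement AND proof) from typ-T2b (g0)'s Lines draft
`F0/P3/Lines-draft/T2b_CohClassRoutingPaydown.lean` ED. 3 sha16 0667cc8e5437939d §3 (:124–:211) into `Theorems/` by F0P3-p03 (g7) (typers cannot file under `Theorems/`;
typ-T2b 15:07:15Z «the Theorems leaf you offered = `localRouting_of_memXiFamily` VERBATIM»), so that BOTH Lines variants of the #82 pay-down (typ-T2a's guarded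
`CohClassRoutingCot`, `stub_localRouting`∕`stub_nonsplitRouting`; typ-T2b's unguarded `CohClassRouting`) close their local glue BY NAME from a ★ module, and the ED. 5 closer can
cite it.  PROOF lane: one theorem, no `def`, no instance declaration, no notation, no `sorry`; `--supports stmt-HodgeConjecture-24833 --as helper`.

THE MATHEMATICS [Rogawski1990 §13.1 p. 199; §12.2 (2) p. 174; §14.2 pp. 233–234; Lemma 3.5.3 (a); §13.3 p. 201]: let `P` lie in the ξ-envelope (★ D6 `MemXiFamily P … ξ`:
a ξ-local family `Pv` contains every finite local constituent of `P`) and let `P` have, at all but finitely many `v`, a `K_v`-spherical admissible unitarizable constituent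
(so the chosen class ★ `clFinChoice P v` is in branch 1: a SPHERICAL member of `Pv v`).  At a SPLIT `v`, `Pv v` is the singleton D6 split packet at the fixed witness, so
`clFinChoice P v` is its `πⁿ`.  At a NON-SPLIT `v`, `Pv v = ⟨x ∘ e₀⁻¹, s⟩` with `x ∈ JH(i_G(χ_ξ,v)) = {πⁿ, π²}` (Keys' labels) and `s` supercuspidal: `s` is excluded because a
supercuspidal class of `U(H)(L⁺_v)` is square-integrable modulo the (compact, ★ A-p19 p825600∕p825780) centre, hence not `K_v`-spherical by (SqNS) transported along a
level-matching congruence (★ K3, typ-T2a p826158); `x = π²` is excluded by (SqNS) at Keys' `L²` label (★ `isSpherical_comap_iff_of_forall_mem_iff`); so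
`clFinChoice P v = πⁿ ∘ e₀⁻¹`, and `e₀` may be replaced by ANY level-matching form congruence `e` because two congruences differ by an inner automorphism (★ K5, typ-T2b
p825897 + p826024: `N = 3` odd).  The exceptional set `S₁` is the union of the three cofinite exceptional sets (`Filter.eventually_cofinite`).
HONEST LABEL: HC_CM is proved only modulo the printed citations until rung 0 closes; this theorem is conditional on the (SqNS) letter through its hypothesis `hSq` only.
-/

set_option autoImplicit false
set_option linter.dupNamespace false

noncomputable section

open NumberField IsDedekindDomain MeasureTheory Filter
open Literature.NumberTheory.Rogawski1990 Literature.NumberTheory.GaloisRepresentations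
open Literature.NumberTheory.Automorphic Literature.NumberTheory.Automorphic.UnitaryGroup
open scoped Matrix Classical ComplexOrder

namespace Summit.HodgeConjecture.HodgeConjecture.Cruxes.H413.F0P3LocalClassRouting

open Summit.HodgeConjecture.HodgeConjecture.Cruxes.H413.F0P3InnerFormClassificationV6
open Summit.HodgeConjecture.HodgeConjecture.Cruxes.H413.F0P3ClassTokenChoice (clFinChoice admUnitConstituents clFinChoice_spec_of_exists_spherical
  mem_admUnitConstituents_iff)

variable (L : Type) [Field L] [NumberField L] [IsCMField L] (H : Matrix (Fin 3) (Fin 3) L)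

/-- **LOCAL ROUTING AT ONE `P` (the glue, stub-free; = typ-T2a's `stub_localRouting` text up to binder order)** — from ξ-ENVELOPE membership `MemXiFamily P … ξ` (the output
of S2♭ at `P`), a cofinite supply of `K_v`-SPHERICAL admissible unitarizable constituents of `P` (K2 at `P`; ★ for cotangent `P`), and the letter (SqNS): off a finite `S₁`,
the chosen class `clFinChoice P v` IS `πⁿ(ξ_v)` in the sense of letter #82 — the D6 split member at a split `v`, the Keys label `πⁿ` transported along ANY level-matching
form congruence at a non-split `v` (both clauses VERBATIM the body of ★ `CohClassRouting`).  Uses ★ K3 (typ-T2a p826158, at the compact centre ★ p825600∕p825780) and ★ K5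
(p825897 + p826024).  (Lifted into `Theorems/` from typ-T2b (g0)'s Lines draft ED. 3 so that both Lines variants close their glue BY NAME.)
[cite: Rogawski1990, §13.1 p. 199; §12.2 (2) p. 174; §14.2 pp. 233–234; §3.5 Lemma 3.5.3 (a) p. 28; §13.3 p. 201] -/
theorem localRouting_of_memXiFamily (hSq : Literature.NumberTheory.Rogawski1990.SquareIntegrableNotSphericalCofinite L)
    (hH : (H.map (cmConjRingHom L))ᵀ = H) (hHd : IsUnit H.det)
    (μ : Measure (adelicGroupData (↥(maximalRealSubfield L)) L (IsCMField.complexConj L) 3 H).automorphicQuotient)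
    [(adelicGroupData (↥(maximalRealSubfield L)) L (IsCMField.complexConj L) 3 H).IsAutomorphicMeasure μ]
    (μω : HeckeCharacter L) (hμu : μω.IsUnitary)
    [∀ v : HeightOneSpectrum (𝓞 ↥(maximalRealSubfield L)), MeasurableSpace (Gqs L v ⧸ Subgroup.center (Gqs L v))]
    [∀ v : HeightOneSpectrum (𝓞 ↥(maximalRealSubfield L)), BorelSpace (Gqs L v ⧸ Subgroup.center (Gqs L v))]
    (μZ : ∀ v : HeightOneSpectrum (𝓞 ↥(maximalRealSubfield L)), Measure (Gqs L v ⧸ Subgroup.center (Gqs L v)))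
    [∀ v : HeightOneSpectrum (𝓞 ↥(maximalRealSubfield L)), (μZ v).IsHaarMeasure]
    (keys : ∀ (ξ : OneDimAutRepH L) (v : HeightOneSpectrum (𝓞 ↥(maximalRealSubfield L))),
      (∀ w : PlacesOver L v, IsCMField.complexConj L • w.1 = w.1) →
        {p : IrrClass (Gqs L v) × IrrClass (Gqs L v) //
          KeysCaseTwoLabels L v (μω.semilocalComponent L v) (torusLocalComponent L (IsCMField.complexConj L) v ξ.η)
            (torusLocalComponent L (IsCMField.complexConj L) v ξ.ψ) p.1 p.2 ∧
          p.1.IsSquareIntegrable (μZ v) ∧ ¬ p.2.IsSquareIntegrable (μZ v)})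
    (P : DiscreteAutomorphicRep (adelicGroupData (↥(maximalRealSubfield L)) L (IsCMField.complexConj L) 3 H) μ) (ξ : OneDimAutRepH L)
    (hmem : MemXiFamily P hH hHd μω hμu ξ)
    (hsph : ∀ᶠ v : HeightOneSpectrum (𝓞 ↥(maximalRealSubfield L)) in cofinite, ∃ c ∈ admUnitConstituents P v, c.IsSpherical (cmLocalIntegralLevel L 3 H v)) :
    ∃ S₁ : Finset (HeightOneSpectrum (𝓞 ↥(maximalRealSubfield L))), ∀ v : HeightOneSpectrum (𝓞 ↥(maximalRealSubfield L)), v ∉ S₁ →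
      (∀ hs : ∃ w : PlacesOver L v, IsCMField.complexConj L • w.1 ≠ w.1,
          clFinChoice P v =
            (cmSplitPacket L H hH hHd v (splitWitness v hs) (splitWitness_spec v hs) (ξ.splitν₀ μω (splitWitness v hs).1)
              (ξ.locψ (splitWitness v hs).1) (ξ.norm_splitν₀_apply hμu (splitWitness v hs).1)
              (ξ.continuous_splitν₀ μω (splitWitness v hs).1) (ξ.norm_locψ_apply (splitWitness v hs).1)
              (ξ.continuous_locψ (splitWitness v hs).1)).πn) ∧
      (∀ hns : ∀ w : PlacesOver L v, IsCMField.complexConj L • w.1 = w.1,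
        ∀ (T : GL (Fin 3) (LocalRing L v)) (a : LocalRing L v) (ha : IsUnit a)
          (h : formCongr (conjLocal L (IsCMField.complexConj L) v) T (H.map (algebraMap L (LocalRing L v))) =
            a • (Matrix.of fun i j : Fin 3 => if i.val + j.val + 1 = 3 then (1 : L) else 0).map (algebraMap L (LocalRing L v))),
          (∀ g : (cmDatum L 3 H).Local v, (cmDatumLocalCongr L v T ha h).symm g ∈ cmLocalIntegralLevel L 3 (qsForm L) v ↔
            g ∈ cmLocalIntegralLevel L 3 H v) →
          clFinChoice P v = IrrClass.comap (cmDatumLocalCongr L v T ha h).symm (keys ξ v hns).1.2) := by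
  obtain ⟨Pv, hfam, hloc⟩ := hmem
  -- ★ K3 (modulo SqNS) and (K4) = SqNS hold cofinitely; so does the K2 supply
  have h3' := hSq.eventually_not_isSupercuspidal_of_isSpherical_congr H
  have hfin := Filter.eventually_cofinite.1 (hsph.and (h3'.and hSq))
  refine ⟨hfin.toFinset, fun v hv => ?_⟩
  have hv' : (∃ c ∈ admUnitConstituents P v, c.IsSpherical (cmLocalIntegralLevel L 3 H v)) ∧
      (IsCompact ((Subgroup.center (Gqs L v) : Subgroup (Gqs L v)) : Set (Gqs L v)) →
        ∀ [MeasurableSpace (Gqs L v ⧸ Subgroup.center (Gqs L v))] [BorelSpace (Gqs L v ⧸ Subgroup.center (Gqs L v))]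
          (μZ' : Measure (Gqs L v ⧸ Subgroup.center (Gqs L v))) [μZ'.IsHaarMeasure]
          (e : (cmDatum L 3 H).Local v ≃ₜ* Gqs L v),
          (∀ g : (cmDatum L 3 H).Local v, e g ∈ cmLocalIntegralLevel L 3 (qsForm L) v ↔ g ∈ cmLocalIntegralLevel L 3 H v) →
          ∀ c : IrrClass ((cmDatum L 3 H).Local v), c.IsSpherical (cmLocalIntegralLevel L 3 H v) → ¬ c.IsSupercuspidal) ∧
      (∀ [MeasurableSpace (Gqs L v ⧸ Subgroup.center (Gqs L v))] [BorelSpace (Gqs L v ⧸ Subgroup.center (Gqs L v))]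
        (μZ' : Measure (Gqs L v ⧸ Subgroup.center (Gqs L v))) [μZ'.IsHaarMeasure] (c : IrrClass (Gqs L v)),
        c.IsSquareIntegrable μZ' → ¬ c.IsSpherical (cmLocalIntegralLevel L 3 (qsForm L) v)) := by
    by_contra hc
    exact hv (hfin.mem_toFinset.2 hc)
  obtain ⟨hex, h3, h4⟩ := hv'
  -- the chosen class is a SPHERICAL constituent (branch 1), hence a member of `Pv v`
  have hspec := clFinChoice_spec_of_exists_spherical P v hex
  have hmemv : clFinChoice P v ∈ (Pv v).members := hloc v (clFinChoice P v) ((mem_admUnitConstituents_iff P v _).1 hspec.1).1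
  refine ⟨fun hs => ?_, fun hns T' a' ha' h' hlev => ?_⟩
  · -- SPLIT `v`: `Pv v` is the singleton split packet at the fixed witness
    rw [hfam.1 v hs, LocalAPacket.mem_members_iff] at hmemv
    rcases hmemv with h | h
    · exact h
    · exact absurd h.symm (Option.some_ne_none _)
  · -- NON-SPLIT `v`: `Pv v = ⟨x ∘ e₀⁻¹, s⟩`, `x ∈ JH(i_G(χ_ξ))`, `s` supercuspidal
    obtain ⟨T₀, a₀, ha₀, h₀, x, s, hPv, hx, hs'⟩ := hfam.2 v hns
    rw [hPv, LocalAPacket.mem_members_iff] at hmemv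
    rcases hmemv with hcl | hcl
    · -- congruence independence (★ K5): replace `e₀ = cmDatumLocalCongr … T₀ …` by the GIVEN `e = cmDatumLocalCongr … T' …`
      obtain ⟨u, hu⟩ := UnitaryGroup.exists_cmDatumLocalCongr_eq_apply_conj L (N := 3) ⟨1, rfl⟩ hH v T₀ T' ha₀ ha' h₀ h'
      have hind : IrrClass.comap (cmDatumLocalCongr L v T₀ ha₀ h₀).symm x = IrrClass.comap (cmDatumLocalCongr L v T' ha' h').symm x :=
        IrrClass.comap_symm_eq_comap_symm_of_forall_eq_conj (cmDatumLocalCongr L v T₀ ha₀ h₀) (cmDatumLocalCongr L v T' ha' h')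
          (cmDatumLocalCongr L v T₀ ha₀ h₀ u) (fun g => by rw [hu g, map_mul, map_mul, map_inv]) x
      change clFinChoice P v = IrrClass.comap (cmDatumLocalCongr L v T₀ ha₀ h₀).symm x at hcl
      rw [hind] at hcl
      -- `x` is one of the two Keys labels
      rcases ((keys ξ v hns).2.1.2 x).1 hx with hxn | hxs
      · rw [hcl, hxn]
      · -- `x = π²` (square-integrable): its transport along the LEVEL-MATCHING `e` would be `K_v`-spherical — contradicts (SqNS)
        exfalso
        have hsph' : (IrrClass.comap (cmDatumLocalCongr L v T' ha' h').symm (keys ξ v hns).1.1).IsSpherical (cmLocalIntegralLevel L 3 H v) := by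
          rw [← hxs, ← hcl]
          exact hspec.2
        exact h4 (μZ v) _ (keys ξ v hns).2.2.1 ((IrrClass.isSpherical_comap_iff_of_forall_mem_iff _ _ hlev).1 hsph')
    · -- `clFinChoice P v = s` supercuspidal — contradicts ★ K3 (it is `K_v`-spherical; compact centre at the non-split `v`, level-matching `e`)
      have hZ : IsCompact ((Subgroup.center (Gqs L v) : Subgroup (Gqs L v)) : Set (Gqs L v)) :=
        (F0P3bLocalNonsplitCompactCenter.local_nonsplit_compactOpen_center_of_center_le L 3 (qsForm L) (isUnit_antidiagOne_det L 3) v hns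
          (forall_mem_center_cmLocal_eq_scalar L (qsForm L) (antidiagOne_isHermitian L 3) (isUnit_antidiagOne_det L 3) v hns)).2
      exact (h3 hZ (μZ v) (cmDatumLocalCongr L v T' ha' h').symm hlev _ hspec.2 (hs' _ hcl)).elim

end Summit.HodgeConjecture.HodgeConjecture.Cruxes.H413.F0P3LocalClassRouting

end
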